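import Literature.NumberTheory.Automorphic.UnitaryThreeAnisotropicStabilizerCosetForm         -- ★ FILE 2c (this seat)
import Literature.NumberTheory.Automorphic.UnitaryThreeAnisotropicStabilizerRealisation      -- ★ FILE 2b-i (this seat)
import Literature.NumberTheory.Automorphic.FixedPointsDoubleCosetUnfolding                    -- ★ `mem_conjSubgroup_iff` (`H′_m = S ∩ d_m K₀ d_m⁻¹` read in `K₀`)
import HarnessLib

/-!
# `Stab(w₀) ⧸ H′_m` CLASSIFIED: equality of cosets ⟺ `q∕s ≡ q′∕s′ (mod 𝔭^m)` and `ι(h) ≡ ι(h′) (mod 𝔭^{2m+1})`, `ι(h) = D_h·Φ(v_h, v₀)`; every `(u, ι)`-class is realised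
# (Flicker 1998, Prop. 16 p. 96 — LAYER B′ step 2, FILE 2d)

Topic `NumberTheory/Automorphic`; namespace `Literature.NumberTheory.Automorphic.UnitaryGroup`.  THEOREMS ONLY (no `def`, no instance, no notation, no named fact, no
`sorry`; count-neutral).  Cell `pub/hodgecm-mathlib`, F0∕P3a road «D-N7-inert», line «N7nsCount» ((F11-c) `stub_irredGValueNeg`); LAYER B′ FILE 2 remainder (LEAD
F0P3a-plan (g9) T8-92: cutting hand A-p13 (g30), design authority B-p10 (g24); plan 2026-09-01T06:18Z).  HONEST LABEL: HC_CM is proved only modulo the printed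
citations until rung 0 closes; this file classifies the cosets, the `Nat.card` transfer to B-p10's ★ p841656 `(q+1)q^{4m}` is FILE 2e.

THE MATHEMATICS.  `S = Stab(w₀) ≤ U(σ, Φ₃)`, `H′_m = S ∩ d_m K₀ d_m⁻¹` (the `subgroupOf` of ★ (F2′)).  (§1) Every `z ∈ S` has coordinates `(b, q, r, s)` (★ (C′)), and
**`zH′_m = z′H′_m ⟺ |s q′ − q s′| ≤ |ϖ^m| ∧ |D′·Φ(v′, v) − D| ≤ |ϖ^{2m+1}|`** (`mk_eq_mk_iff_det_form`: `QuotientGroup.eq` + ★ `mem_conjSubgroup_iff` + ★ FILE 2c on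
`k = z⁻¹z′`).  (§2) Relative to ANY base point `h₀ ∈ S` of the same `q∕s`-class (`|s q₀ − q s₀| ≤ |ϖ^m|`), the second congruence is `|ι(z′) − ι(z)| ≤ |ϖ^{2m+1}|` with
**`ι(z) := D_z·Φ(v_z, v₀)`** (`mk_eq_mk_iff_invariant`; ★ `det_form_congr_iff_of_close`) — a COMPLETE INVARIANT of the coset on the fibre `{q∕s ≡ q₀∕s₀}`: the pair
(`q∕s mod 𝔭^m`, `ι mod 𝔭^{2m+1}`) classifies `S ⧸ H′_m`.  (§3) REALISATION: on the fibre of `h₀` every value `θ·D₀`, `θ ∈ E¹`, of `ι` occurs (`exists_mem_stabilizer_invariant_eq`: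
the element with coordinates `(θ·A₀, q₀, s₀)`, ★ FILE 2b-i), so the fibre is in bijection with `E¹` modulo `𝔭^{2m+1}` — `(q+1)q^{2m}` classes (★ p841656) — over each of the
`q^{2m}` classes of `q∕s ∈ 𝒪_E ⧸ 𝔭^m`.

## References
* [Flicker1998UnitaryFL] Y. Z. Flicker, *Elementary proof of the fundamental lemma for a unitary group*, Canad. J. Math. 50 (1998), Prop. 4 p. 82, Prop. 16 p. 96.
-/

set_option autoImplicit false

noncomputable section

open scoped MatrixGroups WithZero
open Matrix

namespace Literature.NumberTheory.Automorphic

namespace UnitaryGroup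

open Literature.NumberTheory.Automorphic.HermitianLattice Literature.NumberTheory.Automorphic.DoubleCosetFixedPoints

variable {K : Type*} [Field K] [Valued K ℤᵐ⁰] {ϖ : K}
  (σ : K →+* K) {J : Matrix (Fin 3) (Fin 3) K} (hJ : J = (StdForm.antidiagonal 3).over K)

/-! ## §1 Coordinates of stabiliser elements; equality of `H′_m`-cosets in `(D, Φ)` form -/

include hJ in
/-- Every element of `S = Stab(w₀)` has `(b, q, r, s)` coordinates (★ (C′) `exists_coe_eq_of_mulVec_anisoVec_eq`). [cite: Flicker1998UnitaryFL, Prop. 4 p. 82] -/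
theorem exists_coords_of_mem_stabilizer (hd : LocalConjDatum σ ϖ)
    (z : ↥(MulAction.stabilizer (↥(unitaryGroupOfForm σ J)) (![1, 0, -(2 * ϖ)] : Fin 3 → K))) :
    ∃ b q r s : K, (((z : ↥(unitaryGroupOfForm σ J)) : GL (Fin 3) K) : Matrix (Fin 3) (Fin 3) K) =
      !![1 + 2 * ϖ * b, q, b; 2 * ϖ * r, s, r; 4 * ϖ ^ 2 * b, 2 * ϖ * q, 1 + 2 * ϖ * b] :=
  exists_coe_eq_of_mulVec_anisoVec_eq σ hJ hd ((mem_stabilizer_anisoVec_iff σ _ _).1 z.2)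

include hJ in
/-- **`zH′_m = z′H′_m ⟺ |s q′ − q s′| ≤ |ϖ^m| ∧ |D′·Φ(v′, v) − D| ≤ |ϖ^{2m+1}|`** for `z, z′ ∈ S = Stab(w₀)` with coordinates `(b,q,r,s)`, `(b′,q′,r′,s′)`
(`H′_m = ((unitaryInt σ J).map (conj (d m))).subgroupOf S` exactly as in ★ (F2′) `natCard_fixedPoints_unitaryInt_eq_finsum_flickerDiag`; `D = (1+4ϖb)s − 4ϖqr`,
`Φ(v′,v) = σs′·s + 4ϖ·σq′·q`). [cite: Flicker1998UnitaryFL, Prop. 16 p. 96] -/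
theorem mk_eq_mk_iff_det_form (hd : LocalConjDatum σ ϖ) (d : ℕ → ↥(unitaryGroupOfForm σ J)) (m : ℕ)
    (hdm : ((d m : GL (Fin 3) K) : Matrix (Fin 3) (Fin 3) K) = !![ϖ ^ m, 0, 0; 0, 1, 0; 0, 0, (ϖ ^ m)⁻¹])
    {z z' : ↥(MulAction.stabilizer (↥(unitaryGroupOfForm σ J)) (![1, 0, -(2 * ϖ)] : Fin 3 → K))} {b q r s b' q' r' s' : K}
    (hz : (((z : ↥(unitaryGroupOfForm σ J)) : GL (Fin 3) K) : Matrix (Fin 3) (Fin 3) K) =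
      !![1 + 2 * ϖ * b, q, b; 2 * ϖ * r, s, r; 4 * ϖ ^ 2 * b, 2 * ϖ * q, 1 + 2 * ϖ * b])
    (hz' : (((z' : ↥(unitaryGroupOfForm σ J)) : GL (Fin 3) K) : Matrix (Fin 3) (Fin 3) K) =
      !![1 + 2 * ϖ * b', q', b'; 2 * ϖ * r', s', r'; 4 * ϖ ^ 2 * b', 2 * ϖ * q', 1 + 2 * ϖ * b']) :
    (QuotientGroup.mk z : ↥(MulAction.stabilizer (↥(unitaryGroupOfForm σ J)) (![1, 0, -(2 * ϖ)] : Fin 3 → K)) ⧸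
        ((unitaryInt σ J).map (MulAut.conj (d m)).toMonoidHom).subgroupOf
          (MulAction.stabilizer (↥(unitaryGroupOfForm σ J)) (![1, 0, -(2 * ϖ)] : Fin 3 → K))) = QuotientGroup.mk z' ↔
      Valued.v (s * q' - q * s') ≤ Valued.v (ϖ ^ m) ∧
        Valued.v (((1 + 4 * ϖ * b') * s' - 4 * ϖ * q' * r') * (σ s' * s + 4 * ϖ * (σ q' * q)) - ((1 + 4 * ϖ * b) * s - 4 * ϖ * q * r)) ≤
          Valued.v (ϖ ^ (2 * m + 1)) := by
  -- coordinates of `k = z⁻¹ z′ ∈ S`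
  obtain ⟨bk, qk, rk, sk, hk⟩ := exists_coords_of_mem_stabilizer σ hJ hd (z⁻¹ * z')
  have hzk : (z : ↥(unitaryGroupOfForm σ J)) * ((z⁻¹ * z' : ↥(MulAction.stabilizer (↥(unitaryGroupOfForm σ J)) (![1, 0, -(2 * ϖ)] : Fin 3 → K))) :
      ↥(unitaryGroupOfForm σ J)) = (z' : ↥(unitaryGroupOfForm σ J)) := by
    rw [Subgroup.coe_mul, Subgroup.coe_inv, mul_inv_cancel_left]
  rw [QuotientGroup.eq, mem_conjSubgroup_iff (MulAction.stabilizer (↥(unitaryGroupOfForm σ J)) (![1, 0, -(2 * ϖ)] : Fin 3 → K)) (unitaryInt σ J) d m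
    (z⁻¹ * z')]
  exact conj_mem_unitaryInt_iff_det_form σ hJ hd m hdm hz hk hz' hzk

/-! ## §2 The fibrewise invariant `ι(z) = D_z·Φ(v_z, v₀)` -/

include hJ in
/-- **THE COSET INVARIANT**: for `z, z′ ∈ S` and any base element with unit vector `v₀ = (s₀, q₀)` (`N(s₀) + 4ϖN(q₀) = 1`) in the same `q∕s`-class as `z` (`|s q₀ − q s₀| ≤ |ϖ^m|`),
`zH′_m = z′H′_m ⟺ |s q′ − q s′| ≤ |ϖ^m| ∧ |ι(z′) − ι(z)| ≤ |ϖ^{2m+1}|`, `ι(z) := D_z·(σs·s₀ + 4ϖ·σq·q₀)` — the pair (`q∕s mod 𝔭^m`, `ι mod 𝔭^{2m+1}`) classifies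
`S ⧸ H′_m`. [cite: Flicker1998UnitaryFL, Prop. 16 p. 96] -/
theorem mk_eq_mk_iff_invariant (hd : LocalConjDatum σ ϖ) (d : ℕ → ↥(unitaryGroupOfForm σ J)) (m : ℕ)
    (hdm : ((d m : GL (Fin 3) K) : Matrix (Fin 3) (Fin 3) K) = !![ϖ ^ m, 0, 0; 0, 1, 0; 0, 0, (ϖ ^ m)⁻¹])
    {z z' : ↥(MulAction.stabilizer (↥(unitaryGroupOfForm σ J)) (![1, 0, -(2 * ϖ)] : Fin 3 → K))} {b q r s b' q' r' s' s₀ q₀ : K}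
    (hz : (((z : ↥(unitaryGroupOfForm σ J)) : GL (Fin 3) K) : Matrix (Fin 3) (Fin 3) K) =
      !![1 + 2 * ϖ * b, q, b; 2 * ϖ * r, s, r; 4 * ϖ ^ 2 * b, 2 * ϖ * q, 1 + 2 * ϖ * b])
    (hz' : (((z' : ↥(unitaryGroupOfForm σ J)) : GL (Fin 3) K) : Matrix (Fin 3) (Fin 3) K) =
      !![1 + 2 * ϖ * b', q', b'; 2 * ϖ * r', s', r'; 4 * ϖ ^ 2 * b', 2 * ϖ * q', 1 + 2 * ϖ * b'])
    (hv₀ : σ s₀ * s₀ + 4 * ϖ * (σ q₀ * q₀) = 1) (hclose₀ : Valued.v (s * q₀ - q * s₀) ≤ Valued.v (ϖ ^ m)) :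
    (QuotientGroup.mk z : ↥(MulAction.stabilizer (↥(unitaryGroupOfForm σ J)) (![1, 0, -(2 * ϖ)] : Fin 3 → K)) ⧸
        ((unitaryInt σ J).map (MulAut.conj (d m)).toMonoidHom).subgroupOf
          (MulAction.stabilizer (↥(unitaryGroupOfForm σ J)) (![1, 0, -(2 * ϖ)] : Fin 3 → K))) = QuotientGroup.mk z' ↔
      Valued.v (s * q' - q * s') ≤ Valued.v (ϖ ^ m) ∧
        Valued.v (((1 + 4 * ϖ * b') * s' - 4 * ϖ * q' * r') * (σ s' * s₀ + 4 * ϖ * (σ q' * q₀)) -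
            ((1 + 4 * ϖ * b) * s - 4 * ϖ * q * r) * (σ s * s₀ + 4 * ϖ * (σ q * q₀))) ≤ Valued.v (ϖ ^ (2 * m + 1)) := by
  obtain ⟨-, hU2, -⟩ := stabilizer_unitarity_relations σ hJ hd hz
  -- `|D′| = 1`
  have hD' : Valued.v ((1 + 4 * ϖ * b') * s' - 4 * ϖ * q' * r') ≤ 1 := by
    have h := map_det_mul_det_eq_one σ hJ hd hz'
    have hv := congrArg (fun x : K => Valued.v x) h
    simp only [map_mul, hd.vσ, map_one] at hv
    exact mul_self_le_one_iff.1 hv.le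
  rw [mk_eq_mk_iff_det_form σ hJ hd d m hdm hz hz']
  constructor
  · rintro ⟨h1, h2⟩
    exact ⟨h1, (det_form_congr_iff_of_close σ hd m hU2 hv₀ hD' h1 hclose₀).1 h2⟩
  · rintro ⟨h1, h2⟩
    exact ⟨h1, (det_form_congr_iff_of_close σ hd m hU2 hv₀ hD' h1 hclose₀).2 h2⟩

/-! ## §3 Realisation of every invariant value on a fibre -/

include hJ in
/-- **EVERY `ι`-VALUE OCCURS ON EACH FIBRE**: given a stabiliser element `h₀ ↔ (b₀, q₀, r₀, s₀)` and `θ ∈ E¹` (`σθ·θ = 1`), the element with coordinates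
`(A, q, s) = (θ·(1+4ϖb₀), q₀, s₀)` lies in `S` (★ FILE 2b-i), in the fibre of `h₀` (`|s₀q₀ − q₀s₀| = 0`), and has `D = θ·D₀`, so `ι = θ·ι(h₀)` — the fibre surjects onto
`E¹·ι(h₀)` (`(q+1)q^{2m}` classes mod `𝔭^{2m+1}`, ★ p841656). [cite: Flicker1998UnitaryFL, Prop. 16 p. 96] -/
theorem exists_mem_stabilizer_det_eq_mul (hd : LocalConjDatum σ ϖ) {h₀ : ↥(unitaryGroupOfForm σ J)} {b₀ q₀ r₀ s₀ : K}
    (hh₀ : ((h₀ : GL (Fin 3) K) : Matrix (Fin 3) (Fin 3) K) = !![1 + 2 * ϖ * b₀, q₀, b₀; 2 * ϖ * r₀, s₀, r₀; 4 * ϖ ^ 2 * b₀, 2 * ϖ * q₀, 1 + 2 * ϖ * b₀])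
    {θ : K} (hθ : σ θ * θ = 1) :
    ∃ (h : ↥(unitaryGroupOfForm σ J)) (b r : K), h ∈ MulAction.stabilizer (↥(unitaryGroupOfForm σ J)) (![1, 0, -(2 * ϖ)] : Fin 3 → K) ∧
      ((h : GL (Fin 3) K) : Matrix (Fin 3) (Fin 3) K) = !![1 + 2 * ϖ * b, q₀, b; 2 * ϖ * r, s₀, r; 4 * ϖ ^ 2 * b, 2 * ϖ * q₀, 1 + 2 * ϖ * b] ∧
      1 + 4 * ϖ * b = θ * (1 + 4 * ϖ * b₀) ∧
      (1 + 4 * ϖ * b) * s₀ - 4 * ϖ * q₀ * r = θ * ((1 + 4 * ϖ * b₀) * s₀ - 4 * ϖ * q₀ * r₀) := by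
  obtain ⟨-, hU2, -⟩ := stabilizer_unitarity_relations σ hJ hd hh₀
  have hN := stabilizer_norm_A_eq_norm_s σ hJ hd hh₀
  obtain ⟨hs, -, -, -⟩ := stabilizer_valuation_bounds σ hJ hd hh₀
  have hs0 : s₀ ≠ 0 := fun h0 => by rw [h0, map_zero] at hs; exact zero_ne_one hs
  have hσs : σ s₀ ≠ 0 := fun h0 => hs0 (by have h := congrArg σ h0; rwa [hd.σσ, map_zero] at h)
  have h20 : (2 : K) ≠ 0 := fun h0 => by have := hd.v2; rw [h0, map_zero] at this; exact zero_ne_one this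
  have hϖ0 : ϖ ≠ 0 := hd.ϖ_ne_zero
  have h40 : (4 : K) ≠ 0 := by rw [show (4 : K) = 2 * 2 by norm_num]; exact mul_ne_zero h20 h20
  -- the realised element with `A = θ A₀`
  have hR2 : σ (θ * (1 + 4 * ϖ * b₀)) * (θ * (1 + 4 * ϖ * b₀)) = σ s₀ * s₀ := by
    rw [map_mul]; linear_combination (σ (1 + 4 * ϖ * b₀) * (1 + 4 * ϖ * b₀)) * hθ + hN
  obtain ⟨h, hmem, hcoe⟩ := exists_mem_stabilizer_coe_eq_of_norm_relations σ hJ hd hU2 hR2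
  refine ⟨h, (θ * (1 + 4 * ϖ * b₀) - 1) / (4 * ϖ), -(θ * (1 + 4 * ϖ * b₀) * σ q₀) / σ s₀, hmem, hcoe, ?_, ?_⟩
  · field_simp; ring
  · have hr₀ := stabilizer_r_eq σ hJ hd hh₀
    rw [hr₀]
    field_simp
    ring

end UnitaryGroup

end Literature.NumberTheory.Automorphic

end
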